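import Literature.NumberTheory.GaloisRepresentations.ContinuousCohomologyConnecting
import Literature.NumberTheory.GaloisRepresentations.LocalDualityTheorem
import Literature.NumberTheory.EllipticCurves.SubgroupSelmer
import HarnessLib

/-!
# Kummer count on `H¹`: `#H¹(Γ, M)[n] = #H¹(Γ, M[n])` when `M` and `M^Γ` are `n`-divisible

Cell `bsd-eis` (home `run/shared/lean/pub/bsd-eis/`), seat `bsd-line-x1-p1-w2` (gen 1; D-0154 width
seat on crux 2 `GoodLatticeBDPValue` = stmt-BirchSwinnertonDyer-19032, line `halves` v16, stub
`stub_imprimCorank` = `KellerYin2024.prop125_residualPair_unrSelmer_corank_ge`). First brick of the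
LOCAL `≥`-half of KY / CGLS Lemma 1.1.1 per place of `K_∞` ("`corank_{ℤ_p} H¹(K_{∞,η}, (F/𝒪)(θ)) =
𝟙[θ(Frob_w) ≡ Nw]`", LEAD verdict v3.1 §3 item (vii): the class of the tame character) — the
generic cohomological step, for ANY topological group `Γ` and ANY discrete `Γ`-module `M` with
continuous orbit maps:

* `natCard_nsmul_eq_zero_discreteH1_eq` — if multiplication by `n` is onto on `M` AND onto on the
  invariants `M^Γ` (every invariant has an invariant `n`-th root), then
  **`#{x ∈ H¹(Γ, M) : n • x = 0} = #H¹(Γ, M[n])`** (as `Nat.card`, no finiteness assumed): the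
  cohomology sequence of `0 → M[n] → M →(n) M → 0` (tree: `IsSES`, `δ₀_eq_zero_iff`,
  `exists_δ₀_eq_of_map_one_eq_zero`, `exists_map_one_eq_of_map_one_eq_zero`,
  `cohomologyMap_one_eq_nsmul`) reads `M^Γ →(n) M^Γ →(δ₀ = 0) H¹(Γ, M[n]) ↪ H¹(Γ, M) →(n) H¹(Γ, M)`.
* `natCard_torsionBy_discreteH1_eq` — the same with `H¹(Γ, M)[n] = AddSubgroup.torsionBy`.

(The tree's `InertiaCohomologyTorsionBound` has the inequality `#H¹[n] ≤ #H¹(·, A[n])` for the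
inertia group; the curve-specific equality is `FineSelmerCoefficientMap`; this is the generic
equality.) HONEST FRAMING: tool theorems only (no definition, no named fact, no `sorry`); closes
nothing by itself (`--supports stmt-BirchSwinnertonDyer-19032`); BSD / Mazur's main conjecture is
proved for no curve by this file.

References: Serre, *Galois Cohomology* I §2.2 (cohomology sequence); Milne, *ADT* I Lemma 2.9
(shape); Greenberg–Vatsal, Invent. Math. 142 (2000) §2 Prop. (2.4) (use); Keller–Yin
arXiv:2402.12781v2 Lemma 1.1.1.
-/

-- `Summit.BirchSwinnertonDyer.BirchSwinnertonDyer.…`: summit and sub-problem share a name (D-0017 layout).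
set_option linter.dupNamespace false
set_option autoImplicit false

noncomputable section

open scoped Classical AddSubgroup

open CategoryTheory Function
open Literature.NumberTheory.EllipticCurves Literature.NumberTheory.GaloisRepresentations

universe u

namespace Summit.BirchSwinnertonDyer.BirchSwinnertonDyer.Theorems.KummerTorsionH1

variable {Γ : Type u} [Group Γ] [TopologicalSpace Γ] [IsTopologicalGroup Γ]
  {M : Type u} [AddCommGroup M] [DistribMulAction Γ M] [TopologicalSpace M] [DiscreteTopology M]

/-- **Kummer count: `#{x ∈ H¹(Γ, M) : n • x = 0} = #H¹(Γ, M[n])`** for a discrete `Γ`-module `M`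
with continuous orbit maps (`hcont`) on which multiplication by `n` is onto (`hdiv`) and onto on
the invariants (`hinv`: every `Γ`-invariant element has a `Γ`-invariant `n`-th root). The natural
map `H¹(Γ, M[n]) → H¹(Γ, M)` is injective (its kernel is `δ₀(M^Γ/n M^Γ) = 0`) with image the
`n`-torsion (cohomology sequence of `0 → M[n] → M →(n) M → 0`).
[cite: SerreGaloisCohomology1997, I §2.2] [cite: MilneADT2006, I §2 Lemma 2.9] -/
theorem natCard_nsmul_eq_zero_discreteH1_eq (n : ℕ)
    (hcont : ∀ m : M, Continuous fun g : Γ ↦ g • m)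
    (hdiv : ∀ m : M, ∃ m' : M, n • m' = m)
    (hinv : ∀ m : M, (∀ g : Γ, g • m = m) → ∃ m' : M, (∀ g : Γ, g • m' = m') ∧ n • m' = m) :
    Nat.card {x : discreteH1 Γ M // n • x = 0} = Nat.card (discreteH1 Γ ↥(M[(n : ℤ)])) := by
  -- the continuous representations attached to `M` and `M[n]` (definitionally `discreteTopRep`)
  let ρ : ContinuousRep Γ ℤ M :=
    { toRepresentation := (discreteContRep Γ M).toRepresentation
      continuous_smul := continuous_prod_of_discrete_right.mpr hcont }
  have hcont₁ : ∀ b : ↥(M[(n : ℤ)]), Continuous fun g : Γ ↦ g • b := fun b ↦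
    continuous_induced_rng.2 (by
      change Continuous fun g : Γ ↦ ((g • b : ↥(M[(n : ℤ)])) : M)
      simp only [AddSubgroup.torsionBy.coe_smul]
      exact hcont (b : M))
  let ρ₁ : ContinuousRep Γ ℤ ↥(M[(n : ℤ)]) :=
    { toRepresentation := (discreteContRep Γ ↥(M[(n : ℤ)])).toRepresentation
      continuous_smul := continuous_prod_of_discrete_right.mpr hcont₁ }
  have hρ : ρ.toTopRep = discreteTopRep Γ M := rfl
  have hρ₁ : ρ₁.toTopRep = discreteTopRep Γ ↥(M[(n : ℤ)]) := rfl
  -- the inclusion `M[n] ↪ M` and multiplication by `n`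
  let f : ρ₁.toTopRep ⟶ ρ.toTopRep :=
    TopRep.ofHom ⟨⟨(M[(n : ℤ)]).subtype.toIntLinearMap, continuous_of_discreteTopology⟩,
      fun σ ↦ by ext m; rfl⟩
  have hf : ∀ b : ↥(M[(n : ℤ)]), f.hom b = (b : M) := fun _ ↦ rfl
  let g : ρ.toTopRep ⟶ ρ.toTopRep :=
    TopRep.ofHom
      { toLinearMap :=
          { toFun := fun a ↦ n • a
            map_add' := fun a b ↦ nsmul_add a b n
            map_smul' := fun c a ↦ by
              change n • (c • a) = c • (n • a)
              exact smul_comm n c a }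
        cont := continuous_of_discreteTopology
        isIntertwining' := fun σ ↦ by
          refine ContinuousLinearMap.ext fun a ↦ ?_
          change n • ρ.toTopRep.ρ σ a = ρ σ (n • a)
          rw [ContinuousRep.toTopRep_ρ_apply, map_nsmul] }
  have hg : ∀ a : M, g.hom a = n • a := fun _ ↦ rfl
  have hSES : IsSES f g :=
    { comp_eq_zero := by
        ext b
        change n • ((b : ↥(M[(n : ℤ)])) : M) = 0
        exact AddSubgroup.torsionBy.nsmul_iff.mp b.2
      injective := Subtype.val_injective
      exact_mid := fun y hy ↦ ⟨⟨y, AddSubgroup.torsionBy.nsmul_iff.mpr hy⟩, rfl⟩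
      surjective := fun a ↦ hdiv a }
  -- (i) the image of `H¹(f)` is `n`-torsion
  have htor : ∀ y : continuousCohomology 1 ρ₁.toTopRep, n • cohomologyMap f 1 y = 0 := by
    intro y
    obtain ⟨c, rfl⟩ := oneCocycleClass_surjective _ y
    have hc : (n : ℤ) • c = 0 := by
      refine Subtype.ext (ContinuousMap.ext fun σ ↦ Subtype.ext ?_)
      change ((((n : ℤ) • c.1 σ) : ↥(M[(n : ℤ)])) : M) = 0
      rw [natCast_zsmul, AddSubmonoidClass.coe_nsmul]
      exact AddSubgroup.torsionBy.nsmul_iff.mp (c.1 σ).2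
    rw [← map_nsmul, ← Nat.cast_smul_eq_nsmul ℤ, ← oneCocycleClass_smul, hc, oneCocycleClass_zero,
      map_zero]
  -- (ii) `H¹(f)` is injective: its kernel is `δ₀(M^Γ)`, and `δ₀ = 0` by `hinv`
  have hker : ∀ y : continuousCohomology 1 ρ₁.toTopRep, cohomologyMap f 1 y = 0 → y = 0 := by
    intro y hy
    obtain ⟨v, rfl⟩ := hSES.exists_δ₀_eq_of_map_one_eq_zero y hy
    refine (hSES.δ₀_eq_zero_iff v).2 ?_
    obtain ⟨m', hm', hnm'⟩ := hinv (v : M) fun σ ↦ v.2 σ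
    exact ⟨m', fun σ ↦ hm' σ, hnm'⟩
  have hinj : Injective (cohomologyMap f 1) := fun y y' h ↦ by
    have h0 : cohomologyMap f 1 (y - y') = 0 := by rw [map_sub, h, sub_self]
    exact sub_eq_zero.mp (hker _ h0)
  -- (iii) every `n`-torsion class comes from `H¹(Γ, M[n])`
  have hsurj : ∀ x : continuousCohomology 1 ρ.toTopRep, n • x = 0 →
      ∃ y : continuousCohomology 1 ρ₁.toTopRep, cohomologyMap f 1 y = x := by
    intro x hx
    refine hSES.exists_map_one_eq_of_map_one_eq_zero x ?_
    rw [cohomologyMap_one_eq_nsmul ρ g n hg]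
    exact hx
  -- the bijection
  symm
  refine Nat.card_congr (Equiv.ofBijective
    (fun y : continuousCohomology 1 ρ₁.toTopRep ↦
      (⟨cohomologyMap f 1 y, htor y⟩ : {x : discreteH1 Γ M // n • x = 0})) ⟨?_, ?_⟩)
  · intro y y' h
    exact hinj (congrArg Subtype.val h)
  · rintro ⟨x, hx⟩
    obtain ⟨y, hy⟩ := hsurj x hx
    exact ⟨y, Subtype.ext hy⟩

/-- **`#H¹(Γ, M)[n] = #H¹(Γ, M[n])`** (`AddSubgroup.torsionBy` currency of
`natCard_nsmul_eq_zero_discreteH1_eq`). [cite: SerreGaloisCohomology1997, I §2.2]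
[cite: MilneADT2006, I §2 Lemma 2.9] -/
theorem natCard_torsionBy_discreteH1_eq (n : ℕ)
    (hcont : ∀ m : M, Continuous fun g : Γ ↦ g • m)
    (hdiv : ∀ m : M, ∃ m' : M, n • m' = m)
    (hinv : ∀ m : M, (∀ g : Γ, g • m = m) → ∃ m' : M, (∀ g : Γ, g • m' = m') ∧ n • m' = m) :
    Nat.card ((discreteH1 Γ M)[(n : ℤ)]) = Nat.card (discreteH1 Γ ↥(M[(n : ℤ)])) := by
  rw [← natCard_nsmul_eq_zero_discreteH1_eq n hcont hdiv hinv]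
  exact Nat.card_congr (Equiv.subtypeEquivRight fun _ ↦ AddSubgroup.torsionBy.nsmul_iff)

end Summit.BirchSwinnertonDyer.BirchSwinnertonDyer.Theorems.KummerTorsionH1

end
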